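import Summits.Ventures.AbcSig.Levels.N5536P1
import Summits.Ventures.AbcSig.Levels.N5536P2

/-!
# Venture AbcSig — GENERATED level file, level 5536 (AGGREGATOR of 2 part files)

HONEST FRAMING. As in the part files `N5536<part>.lean`, parts P1, P2 (a MIXED split: parts of
different size-splits of the same generator output landed in the tree at different times; every part carries the orbit
blocks of one contiguous run of orbits of the same certified level file `N5536.engine1.json`,
sha256 `5781f0f2240492395f91ca43b53492cd4f644ffb4627493e5d3f739120df3a48`): this file only concatenates the orbit lists and the part summaries into
`level5536Orbits`, `level5536_wellformed`, `level5536_sieve` (the shapes the row templates consume). The split exists because the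
tree's files are ≤ 400 lines and ≤ 200 000 bytes. Union of residual exponents ≥ 7: [7, 37]; orbits not eliminable by
the sieve: none. No Diophantine statement is made here; no claim on ABC or any summit.
-/

namespace Summit.Ventures.AbcSig

/-- All newform orbits of level 5536 (concatenation of the parts, engine order). -/
def level5536Orbits : List OrbitData :=
  level5536OrbitsP1 ++ level5536OrbitsP2

/-- Every listed entry is at an odd prime not dividing 5536. -/
theorem level5536_wellformed :
    ∀ o ∈ level5536Orbits, ∀ e ∈ o.coeffs, e.ell.Prime ∧ e.ell ≠ 2 ∧ ¬ e.ell ∣ 5536 := by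
  unfold level5536Orbits
  exact List.forall_mem_append.2 ⟨level5536_wellformedP1, level5536_wellformedP2⟩

/-- **Level 5536 summary.** For a prime exponent `n ≥ 7`, every orbit of level 5536 is sieve-eliminated by the
kernel certificates of the part files, except that the row's predicate `X` is assumed for: orbit_5536_7 if n ∈ [37], orbit_5536_9 if n ∈ [7], orbit_5536_10 if n ∈ [7]. -/
theorem level5536_sieve (n : ℕ) (hn : n.Prime) (hmin : 7 ≤ n) (X : OrbitData → Prop)
    (h_orbit_5536_7 : n ∈ ([37] : List ℕ) → X orbit_5536_7)
    (h_orbit_5536_9 : n ∈ ([7] : List ℕ) → X orbit_5536_9)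
    (h_orbit_5536_10 : n ∈ ([7] : List ℕ) → X orbit_5536_10) :
    ∀ o ∈ level5536Orbits, (∀ e ∈ o.coeffs, e.ell.Prime ∧ e.ell ≠ 2 ∧ ¬ e.ell ∣ 5536) ∧ (o.Eliminated bs04Allowed n ∨ X o) := by
  unfold level5536Orbits
  exact List.forall_mem_append.2 ⟨(level5536_sieveP1 n hn hmin X h_orbit_5536_7 h_orbit_5536_9), (level5536_sieveP2 n hn hmin X h_orbit_5536_10)⟩

end Summit.Ventures.AbcSig
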